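import Summits.QuantumFields.YangMills.Theorems.BalabanUVNodesN22AtRecordOfGenAnalyticReading

/-!
# BalabanUVNodes ∕ node N22 = NE9 — THE LAST-COUPLING SCHEMAS FROM HOLOMORPHY IN THE COMPLEX LAST COUPLING, AND ROAD 2 AT THE RECORD FROM ANALYTICITY ALONE: the schemas
# (G-T1-last), (G-T2-last) of modules J53∕J57∕J58 on node00-def-W1's one-step map from SECTOR holomorphy (relative discs, centred quadratic bound) or from a UNIFORM coupling
# margin; hence K3's `h9` from node N18's kernel step rate + analyticity in the older terms (J57∕J58) + analyticity in the last coupling — no Lipschitz schema left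

Cell `pub-ymgap`, HUMAN RULING D-0062 (Track A), R134 seat `pub-ymgap-dag-n22-c` (strategy s1), generation 18, module J59.  THEOREMS ONLY (no `def`, no `sorry`, standard axioms);
`--kind proof --supports stmt-QuantumFields-27366 --as helper` (K3⁸ `SpineGivenEndpointR13SepCoPHV`), COUNT-NEUTRAL.  Imports module J58 `…N22AtRecordOfGenAnalyticReading` (through it
J57's analytic reading, J54, J45's `norm_secondDiff_le_of_sectorHolo`, J39's `norm_secondDiff_le_of_coordHolo`, `Dimock2015.norm_sub_le_of_margin`).  Nothing re-declared.

WHY.  After J57∕J58, ROAD 2's generator-currency bill displays, besides node N18's letter and the analytic reading (AR) in the older terms, two LAST-coupling schemas: (G-T1-last)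
(first order, `lam ≤ ℓ₁`) and (G-T2-last) (second differences `≤ lam₂·d²·e^{−κd}`) — [I] p. 263's «C^∞-function of g_{j−1} ∈ [0, γ] (or analytic)» with constants.  def-W1's
generator takes a COMPLEX last coupling (`StepGen.E : ℂ → …`, for exactly this clause), so both follow from holomorphy in `z = g_k` by Cauchy, in either of the lane's two typings:
* SECTOR typing (possibility-1-compatible, module J45∕J46): holomorphic on `O ⊇ closedBall s (c·s)` for `s ∈ ]0, γ]` (no disc meets `0` for `c < 1`) with the CENTRED QUADRATIC BOUND
  `‖E(z) − V‖ ≤ B_q·e^{−κd}·s²` ⟹ `lam = B_qγ∕c` (§1 ★ `norm_sub_le_of_sectorHolo`: Cauchy on the circle of radius `c s` gives `‖E′(s)‖ ≤ B_q s∕c`, then the real mean value) and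
  `lam₂ = (6c² + 32c + 64)∕c²·B_q` (J45) — ★ `genT1last_of_lastSectorHolo`, ★ `genT2last_of_lastSectorHolo`;
* ONE-RADIUS typing (possibility 2, [I] p. 266; module J39∕J40): holomorphic on `O ⊇ closedBall s ρ₀` with `‖E(z)‖ ≤ B₀·e^{−κd}` on `O` ⟹ `lam = 4B₀∕ρ₀` (Dimock's margin lemma),
  `lam₂ = 64B₀∕ρ₀²` (J39) — ★ `genT1last_of_lastCoordHolo`, ★ `genT2last_of_lastCoordHolo`.
§3 ★★★ `ne9_EA_objectsOfRecord₁₃_of_kernelStepRate_genAnalytic` — K3's `h9` ON ROAD 2 FROM ANALYTICITY ALONE (J58 §1 with the sector typing of §2): N18's letter + (AR) in the older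
terms + the sector datum in the last coupling + (Adm-run) + output bound ∕ readings ∕ tails ∕ law ∕ (1.21) + rows.  (Socket and pin face: module J60.)

HONEST FRAMING (binding).  Count-neutral COMPOSITION; the sector ∕ one-radius data and (AR) are HYPOTHESIS SHAPES on def-W1's generator (the cell's readings of [I] p. 263, p. 266,
[II] (2.14)–(2.15) p. 15 — NOT printed as such; GAPS G-ne9p2-5, G-t4-U3-1∕-3; producer: node N09 ∕ N10 ∕ NODE A on def-T's generator of record; inhabited by every generator
constant in `(z, old)` — A5, conditional content); NO estimate of Bałaban's is proved or asserted; nothing of the record is constructed or claimed to meet the displayed inputs.  N22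
is NOT discharged (typed 28∕28 · discharged 5∕27 UNCHANGED); K3⁸ OPEN and NOT claimed; NE9 is NOT IN PRINT for d = 4; no count claim; one finite 𝕋⁴ programme at fixed ε — R4
closes the CONDITIONAL rung `BalabanLadder.UV` only; NOTHING about the continuum limit, ℝ⁴, infinite volume, OS axioms, a mass gap or the Clay problem is proved or claimed.
References (TYPES only): [I] = Bałaban, CMP 109 (1987) (0.23) p. 256, §1 p. 263 ((1.17)–(1.18)), p. 266, (2.12)–(2.13) p. 268, p. 282, §5 p. 298; [II] = CMP 116 (1988) (1.41) p. 11,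
(2.13)–(2.15) pp. 14–15, p. 18, (2.41) p. 21; King, CMP 102 (1986) Lemma 4.5 (4.38).
-/

noncomputable section

open Set Metric
open scoped BigOperators

namespace YMDAG.N22.TermRecursion

open Literature.MathematicalPhysics.QuantumFieldTheory.Balaban1983to89
open Literature.MathematicalPhysics.QuantumFieldTheory.Balaban1983to89.T4OutputRate (Window)
open Literature.MathematicalPhysics.QuantumFieldTheory.Balaban1983to89.Node00.Sect2 (domSys CPair)
open Literature.MathematicalPhysics.QuantumFieldTheory.Balaban1983to89.Node00.W1
open Literature.MathematicalPhysics.QuantumFieldTheory.Dimock2015 (norm_sub_le_of_margin)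
open YMDAG.N22.KernelFading (norm_secondDiff_le_of_sectorHolo)
open YMDAG.N22.WindowedSecondDiff (norm_secondDiff_le_of_coordHolo)

/-! ## §1 Complex analysis: first differences from SECTOR holomorphy with a centred quadratic bound -/

/-- ★ **FIRST DIFFERENCES FROM SECTOR HOLOMORPHY WITH A CENTRED QUADRATIC BOUND (Cauchy at first order on RELATIVE discs).**  If `Ec` is holomorphic on a set `O` containing the
closed discs `closedBall s (c·s)` about every `s ∈ ]0, γ]` (`c > 0`) and `‖Ec z − V‖ ≤ B·s²` on those discs for a fixed value `V`, then `‖Ec′(s)‖ ≤ B s²∕(c s) ≤ Bγ∕c` on `]0, γ]`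
(Cauchy on the circle of radius `c s`), hence for `t, t′ ∈ ]0, γ]`: **`‖Ec t − Ec t′‖ ≤ (Bγ∕c)·|t − t′|`** (real mean value along the segment). [folklore] -/
theorem norm_sub_le_of_sectorHolo {Ec : ℂ → ℂ} {O : Set ℂ} {γ c B : ℝ} {V : ℂ} (hc : 0 < c) (hB : 0 ≤ B)
    (hhol : DifferentiableOn ℂ Ec O) (hball : ∀ s ∈ Ioc (0 : ℝ) γ, closedBall (s : ℂ) (c * s) ⊆ O)
    (hbd : ∀ s ∈ Ioc (0 : ℝ) γ, ∀ z ∈ closedBall (s : ℂ) (c * s), ‖Ec z - V‖ ≤ B * s ^ 2)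
    {t t' : ℝ} (ht : t ∈ Ioc (0 : ℝ) γ) (ht' : t' ∈ Ioc (0 : ℝ) γ) :
    ‖Ec (t : ℂ) - Ec (t' : ℂ)‖ ≤ B * γ / c * |t - t'| := by
  -- derivative bound at every point of the window
  have hder : ∀ s ∈ Ioc (0 : ℝ) γ, ‖deriv Ec (s : ℂ)‖ ≤ B * γ / c := by
    intro s hs
    have hcs : 0 < c * s := mul_pos hc hs.1
    set Fv : ℂ → ℂ := fun z => Ec z - V with hFv
    have hholF : DifferentiableOn ℂ Fv (closedBall (s : ℂ) (c * s)) := (hhol.mono (hball s hs)).sub_const V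
    have hdc : DiffContOnCl ℂ Fv (ball (s : ℂ) (c * s)) := by
      refine DifferentiableOn.diffContOnCl ?_
      rw [closure_ball _ hcs.ne']
      exact hholF
    have hsph : ∀ z ∈ sphere (s : ℂ) (c * s), ‖Fv z‖ ≤ B * s ^ 2 := fun z hz => hbd s hs z (sphere_subset_closedBall hz)
    have h := Complex.norm_deriv_le_of_forall_mem_sphere_norm_le hcs hdc hsph
    have hderiv_eq : deriv Fv (s : ℂ) = deriv Ec (s : ℂ) := by
      rw [hFv]
      exact deriv_sub_const V
    rw [hderiv_eq] at h
    refine h.trans ?_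
    rw [div_le_div_iff₀ hcs hc]
    have hmono := mul_le_mul_of_nonneg_left hs.2 (mul_nonneg (mul_nonneg hB hc.le) hs.1.le : (0 : ℝ) ≤ B * c * s)
    calc B * s ^ 2 * c = B * c * s * s := by ring
      _ ≤ B * c * s * γ := hmono
      _ = B * γ * (c * s) := by ring
  -- differentiability at the (interior) points of the window
  have hdiff : ∀ s ∈ Ioc (0 : ℝ) γ, DifferentiableAt ℂ Ec (s : ℂ) := fun s hs =>
    hhol.differentiableAt (Filter.mem_of_superset (closedBall_mem_nhds _ (mul_pos hc hs.1)) (hball s hs))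
  -- real mean value on the segment between `t'` and `t`
  have key : ∀ a b : ℝ, a ∈ Ioc (0 : ℝ) γ → b ∈ Ioc (0 : ℝ) γ → a ≤ b → ‖Ec (b : ℂ) - Ec (a : ℂ)‖ ≤ B * γ / c * (b - a) := by
    intro a b ha hb hab
    have hseg : ∀ τ ∈ Icc a b, τ ∈ Ioc (0 : ℝ) γ := fun τ hτ => ⟨ha.1.trans_le hτ.1, hτ.2.trans hb.2⟩
    have hderiv : ∀ τ ∈ Icc a b, HasDerivWithinAt (fun s : ℝ => Ec ((s : ℝ) : ℂ)) (deriv Ec ((τ : ℝ) : ℂ)) (Icc a b) τ := fun τ hτ =>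
      ((hdiff τ (hseg τ hτ)).hasDerivAt.comp_ofReal).hasDerivWithinAt
    have h := norm_image_sub_le_of_norm_deriv_le_segment' hderiv (fun τ hτ => hder τ (hseg τ (Ico_subset_Icc_self hτ))) b (right_mem_Icc.2 hab)
    simpa using h
  rcases le_total t' t with h | h
  · rw [abs_of_nonneg (sub_nonneg.mpr h)]
    exact key t' t ht' ht h
  · rw [abs_of_nonpos (sub_nonpos.mpr h), norm_sub_rev, neg_sub]
    exact key t t' ht ht' h


/-! ## §2 ★ The last-coupling schemas (G-T1-last), (G-T2-last) of modules J53∕J57∕J58 from holomorphy of the one-step map in its COMPLEX last coupling -/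
section Gen

variable {P : Params} {𝔸 : Type} {M : ℕ} (G : GenTower P 𝔸 M) (sp : (k : ℕ) → (domSys P M (k + 1)).Dom → Set (CPair P 𝔸))
  (Adm : (k : ℕ) → OlderTerms P 𝔸 M k → Prop)

/-- ★ **(G-T1-last) FROM SECTOR HOLOMORPHY IN THE LAST COUPLING (possibility-1-compatible typing: relative discs `closedBall s (c·s)`, none through zero coupling).**  If at every
admissible older-term family the one-step map `z ↦ (G k).E z old φ X` is holomorphic on a set `O ⊇ closedBall s (c·s)` (`s ∈ ]0, γ]`) with the CENTRED QUADRATIC BOUND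
`‖(G k).E z old φ X − V‖ ≤ B_q·e^{−κd_{k+1}(X)}·s²` on those discs (some value `V = V k old φ X`), then for `t, t′ ∈ ]0, γ]`:
**`‖(G k).E t old φ X − (G k).E t′ old φ X‖ ≤ e^{−κd}·(B_qγ∕c)·|t − t′|`** — §1's `norm_sub_le_of_sectorHolo`. [folklore] -/
theorem genT1last_of_lastSectorHolo {O : Set ℂ} {γ κ c Bq : ℝ} (V : (k : ℕ) → OlderTerms P 𝔸 M k → CPair P 𝔸 → (domSys P M (k + 1)).Dom → ℂ) (hc : 0 < c) (hBq : 0 ≤ Bq)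
    (hball : ∀ s ∈ Ioc (0 : ℝ) γ, closedBall (s : ℂ) (c * s) ⊆ O)
    (hhol : ∀ (k : ℕ) (old : OlderTerms P 𝔸 M k), Adm k old → ∀ (X : (domSys P M (k + 1)).Dom), ∀ φ ∈ sp k X, DifferentiableOn ℂ (fun z => (G k).E z old φ X) O)
    (hbd : ∀ (k : ℕ) (old : OlderTerms P 𝔸 M k), Adm k old → ∀ (X : (domSys P M (k + 1)).Dom), ∀ φ ∈ sp k X, ∀ s ∈ Ioc (0 : ℝ) γ, ∀ z ∈ closedBall (s : ℂ) (c * s),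
      ‖(G k).E z old φ X - V k old φ X‖ ≤ Bq * Real.exp (-(κ * (domSys P M (k + 1)).dj X)) * s ^ 2) :
    ∀ (k : ℕ), ∀ t ∈ Ioc (0 : ℝ) γ, ∀ t' ∈ Ioc (0 : ℝ) γ, ∀ (old : OlderTerms P 𝔸 M k), Adm k old → ∀ (X : (domSys P M (k + 1)).Dom), ∀ φ ∈ sp k X,
      ‖(G k).E ((t : ℝ) : ℂ) old φ X - (G k).E ((t' : ℝ) : ℂ) old φ X‖ ≤ Real.exp (-(κ * (domSys P M (k + 1)).dj X)) * (Bq * γ / c * |t - t'|) := by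
  intro k t ht t' ht' old hold X φ hφ
  have he : 0 ≤ Bq * Real.exp (-(κ * (domSys P M (k + 1)).dj X)) := mul_nonneg hBq (Real.exp_pos _).le
  have h := norm_sub_le_of_sectorHolo hc he (hhol k old hold X φ hφ) hball (hbd k old hold X φ hφ) ht ht'
  refine h.trans (le_of_eq ?_)
  ring

/-- ★ **(G-T2-last) FROM SECTOR HOLOMORPHY IN THE LAST COUPLING**: under the same sector datum, for `d > 0` with `t ± d ∈ ]0, γ]`:
**`‖(G k).E (t+d) old φ X − 2(G k).E t old φ X + (G k).E (t−d) old φ X‖ ≤ e^{−κd_{k+1}(X)}·((6c² + 32c + 64)∕c²·B_q)·d²`** — module J45's `norm_secondDiff_le_of_sectorHolo`. [folklore] -/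
theorem genT2last_of_lastSectorHolo {O : Set ℂ} {γ κ c Bq : ℝ} (V : (k : ℕ) → OlderTerms P 𝔸 M k → CPair P 𝔸 → (domSys P M (k + 1)).Dom → ℂ) (hc : 0 < c) (hBq : 0 ≤ Bq)
    (hball : ∀ s ∈ Ioc (0 : ℝ) γ, closedBall (s : ℂ) (c * s) ⊆ O)
    (hhol : ∀ (k : ℕ) (old : OlderTerms P 𝔸 M k), Adm k old → ∀ (X : (domSys P M (k + 1)).Dom), ∀ φ ∈ sp k X, DifferentiableOn ℂ (fun z => (G k).E z old φ X) O)
    (hbd : ∀ (k : ℕ) (old : OlderTerms P 𝔸 M k), Adm k old → ∀ (X : (domSys P M (k + 1)).Dom), ∀ φ ∈ sp k X, ∀ s ∈ Ioc (0 : ℝ) γ, ∀ z ∈ closedBall (s : ℂ) (c * s),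
      ‖(G k).E z old φ X - V k old φ X‖ ≤ Bq * Real.exp (-(κ * (domSys P M (k + 1)).dj X)) * s ^ 2) :
    ∀ (k : ℕ) (old : OlderTerms P 𝔸 M k), Adm k old → ∀ (t d : ℝ), 0 < d → t - d ∈ Ioc (0 : ℝ) γ → t + d ∈ Ioc (0 : ℝ) γ →
      ∀ (X : (domSys P M (k + 1)).Dom), ∀ φ ∈ sp k X,
        ‖(G k).E ((t + d : ℝ) : ℂ) old φ X - 2 * (G k).E ((t : ℝ) : ℂ) old φ X + (G k).E ((t - d : ℝ) : ℂ) old φ X‖ ≤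
          Real.exp (-(κ * (domSys P M (k + 1)).dj X)) * ((6 * c ^ 2 + 32 * c + 64) / c ^ 2 * Bq * d ^ 2) := by
  intro k old hold t d hd hm hp X φ hφ
  have he : 0 ≤ Bq * Real.exp (-(κ * (domSys P M (k + 1)).dj X)) := mul_nonneg hBq (Real.exp_pos _).le
  have h := norm_secondDiff_le_of_sectorHolo (Ec := fun z => (G k).E z old φ X) hc he (hhol k old hold X φ hφ) hball (hbd k old hold X φ hφ) hd hm hp
  refine h.trans (le_of_eq ?_)
  ring

/-- ★ **(G-T1-last) FROM A UNIFORM COUPLING MARGIN (possibility-2 typing: one radius `ρ₀` about every point of `]0, γ]`).**  If at every admissible older-term family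
`z ↦ (G k).E z old φ X` is holomorphic on `O ⊇ closedBall s ρ₀` (`s ∈ ]0, γ]`) with `‖(G k).E z old φ X‖ ≤ B₀·e^{−κd_{k+1}(X)}` on `O`, then for `t, t′ ∈ ]0, γ]`:
**`‖(G k).E t old φ X − (G k).E t′ old φ X‖ ≤ e^{−κd}·(4B₀∕ρ₀)·|t − t′|`** — `Dimock2015.norm_sub_le_of_margin` on the read window. [folklore] -/
theorem genT1last_of_lastCoordHolo {O : Set ℂ} {γ κ ρ₀ B₀ : ℝ} (hρ₀ : 0 < ρ₀)
    (hball : ∀ s ∈ Ioc (0 : ℝ) γ, closedBall (s : ℂ) ρ₀ ⊆ O)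
    (hhol : ∀ (k : ℕ) (old : OlderTerms P 𝔸 M k), Adm k old → ∀ (X : (domSys P M (k + 1)).Dom), ∀ φ ∈ sp k X, DifferentiableOn ℂ (fun z => (G k).E z old φ X) O)
    (hbd : ∀ (k : ℕ) (old : OlderTerms P 𝔸 M k), Adm k old → ∀ (X : (domSys P M (k + 1)).Dom), ∀ φ ∈ sp k X, ∀ z ∈ O,
      ‖(G k).E z old φ X‖ ≤ B₀ * Real.exp (-(κ * (domSys P M (k + 1)).dj X))) :
    ∀ (k : ℕ), ∀ t ∈ Ioc (0 : ℝ) γ, ∀ t' ∈ Ioc (0 : ℝ) γ, ∀ (old : OlderTerms P 𝔸 M k), Adm k old → ∀ (X : (domSys P M (k + 1)).Dom), ∀ φ ∈ sp k X,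
      ‖(G k).E ((t : ℝ) : ℂ) old φ X - (G k).E ((t' : ℝ) : ℂ) old φ X‖ ≤ Real.exp (-(κ * (domSys P M (k + 1)).dj X)) * (4 * B₀ / ρ₀ * |t - t'|) := by
  intro k t ht t' ht' old hold X φ hφ
  have hS : ∀ y ∈ ((↑) : ℝ → ℂ) '' Ioc (0 : ℝ) γ, closedBall y ρ₀ ⊆ O := by
    rintro _ ⟨s, hs, rfl⟩
    exact hball s hs
  have h := norm_sub_le_of_margin hρ₀ (hhol k old hold X φ hφ) (hbd k old hold X φ hφ) hS (mem_image_of_mem _ ht) (mem_image_of_mem _ ht')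
  rw [← Complex.ofReal_sub, Complex.norm_real, Real.norm_eq_abs] at h
  refine h.trans (le_of_eq ?_)
  ring

/-- ★ **(G-T2-last) FROM A UNIFORM COUPLING MARGIN**: under the same one-radius datum, for `d > 0` with `t ± d ∈ ]0, γ]`:
**`‖(G k).E (t+d) old φ X − 2(G k).E t old φ X + (G k).E (t−d) old φ X‖ ≤ e^{−κd_{k+1}(X)}·(64B₀∕ρ₀²)·d²`** — module J39's `norm_secondDiff_le_of_coordHolo`. [folklore] -/
theorem genT2last_of_lastCoordHolo {O : Set ℂ} {γ κ ρ₀ B₀ : ℝ} (hρ₀ : 0 < ρ₀) (hB₀ : 0 ≤ B₀)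
    (hball : ∀ s ∈ Ioc (0 : ℝ) γ, closedBall (s : ℂ) ρ₀ ⊆ O)
    (hhol : ∀ (k : ℕ) (old : OlderTerms P 𝔸 M k), Adm k old → ∀ (X : (domSys P M (k + 1)).Dom), ∀ φ ∈ sp k X, DifferentiableOn ℂ (fun z => (G k).E z old φ X) O)
    (hbd : ∀ (k : ℕ) (old : OlderTerms P 𝔸 M k), Adm k old → ∀ (X : (domSys P M (k + 1)).Dom), ∀ φ ∈ sp k X, ∀ z ∈ O,
      ‖(G k).E z old φ X‖ ≤ B₀ * Real.exp (-(κ * (domSys P M (k + 1)).dj X))) :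
    ∀ (k : ℕ) (old : OlderTerms P 𝔸 M k), Adm k old → ∀ (t d : ℝ), 0 < d → t - d ∈ Ioc (0 : ℝ) γ → t + d ∈ Ioc (0 : ℝ) γ →
      ∀ (X : (domSys P M (k + 1)).Dom), ∀ φ ∈ sp k X,
        ‖(G k).E ((t + d : ℝ) : ℂ) old φ X - 2 * (G k).E ((t : ℝ) : ℂ) old φ X + (G k).E ((t - d : ℝ) : ℂ) old φ X‖ ≤
          Real.exp (-(κ * (domSys P M (k + 1)).dj X)) * (64 * B₀ / ρ₀ ^ 2 * d ^ 2) := by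
  intro k old hold t d hd hm hp X φ hφ
  have he : 0 ≤ B₀ * Real.exp (-(κ * (domSys P M (k + 1)).dj X)) := mul_nonneg hB₀ (Real.exp_pos _).le
  have h := norm_secondDiff_le_of_coordHolo (Ec := fun z => (G k).E z old φ X) hρ₀ he (hhol k old hold X φ hφ) hball (hbd k old hold X φ hφ) hd hm hp
  refine h.trans (le_of_eq ?_)
  ring

end Gen

end YMDAG.N22.TermRecursion

namespace YMDAG.N22.KernelFading

open Literature.MathematicalPhysics.QuantumFieldTheory.Balaban1983to89
open Literature.MathematicalPhysics.QuantumFieldTheory.Balaban1983to89.T4Continuum (T4Family ULoop)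
open Literature.MathematicalPhysics.QuantumFieldTheory.Balaban1983to89.T4OutputRate (Window NE9)
open Literature.MathematicalPhysics.QuantumFieldTheory.Balaban1983to89.TreeLengthTorus (TPt)
open Literature.MathematicalPhysics.QuantumFieldTheory.Balaban1983to89.B12TreeDecay (K₀ kappa₀)
open Literature.MathematicalPhysics.QuantumFieldTheory.Balaban1983to89.B12Decay510 (delta1)
open Literature.MathematicalPhysics.QuantumFieldTheory.Balaban1983to89.B12Decay510Window (K₁)
open Literature.MathematicalPhysics.QuantumFieldTheory.Balaban1983to89.B12Decay510Torus (distCT nearT)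
open Literature.MathematicalPhysics.QuantumFieldTheory.Balaban1983to89.Node00 (Stage13Params Stage13HParams U3Letters₁₁ MatA)
open Literature.MathematicalPhysics.QuantumFieldTheory.Balaban1983to89.Node00.Sect2 (domSys domCount CPair)
open Literature.MathematicalPhysics.QuantumFieldTheory.Balaban1983to89.Node00.W1
open Literature.MathematicalPhysics.QuantumFieldTheory.Balaban1983to89.Node00.LocalizedSum17 (ReadingMaps Localizes17OfRecord₁₃)
open Literature.MathematicalPhysics.QuantumFieldTheory.Balaban1983to89.Node00.U3OfKernels (histPrefix objectsOfRecord₁₃)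
open Literature.MathematicalPhysics.QuantumFieldTheory.Balaban1983to89.Node00.U3KernelLetters (KernelStepRateOfRecord₁₃ PolLimitsExistOfRecord₁₃)
open YMDAG.UVSplit (N22At u3OfRecord₁₃ RateReading₁₃CoPH rateCarriersOfRecord₁₃CoPH)
open YMDAG.N22.AtKernels (n22At_rateCarriers_of_kernels_pin_of_ne9 n22At_u3OfRecord₁₃_objectsOfRecord₁₃_iff)
open YMDAG.N22.TermRecursion (genT1last_of_lastSectorHolo genT2last_of_lastSectorHolo)

open scoped Matrix.Norms.L2Operator

variable (F : T4Family) (N : ℕ) [NeZero N] {𝔸 : Type} {M : ℕ}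

/-! ## §3 ★★★ K3's `h9` on ROAD 2 FROM ANALYTICITY ALONE: N18's kernel step rate + the analytic reading in the older terms + sector holomorphy in the last coupling -/

open Classical Finset in
/-- ★★★ **K3's `h9` ON ROAD 2 FROM ANALYTICITY ALONE.**  Module J58 §1 with its two LAST-coupling schemas DISCHARGED by §2 from SECTOR HOLOMORPHY of the one-step map in its complex
last coupling (per torus a set `O K ⊇ closedBall s (c_S·s)` for `s ∈ ]0, θ.γ]`, the map holomorphic there at admissible older terms, with the centred quadratic bound
`‖((Gn K) k).E z old φ X − V‖ ≤ B_q·e^{−κ_E d}·s²`): the inputs are node N18's `KernelStepRateOfRecord₁₃`, the ANALYTIC READING (AR) of J57 in the older terms, the sector datum in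
the last coupling, (Adm-run), the output bound ∕ term holomorphy through the readings ∕ chart ∕ space clause ∕ tails at the run towers, W1-20's law, (1.21), and the rows of J58 at
`ℓ₁ = B_qγ∕c_S`, `ℓ₂ = (6c_S² + 32c_S + 64)∕c_S²·B_q`, `c = 4M_b c_w∕ϱ`, `c_b = 64M_b c_w²∕ϱ²` (`ℓ.θ₅·ν ≤ ℓ.ω²`, `ν > ω₁ + c`, `ν ≥ (ω₁ + c)²`, `ν ≥ 1`) ⟹
**`NE9 ((objectsOfRecord₁₃ F N θ ℓ).EA 0) (Window θ.γ) ℓ.κ ℓ.moduli`**.  NO Lipschitz ∕ second-order SCHEMA remains among the inputs: every regularity input is «analyticity + size on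
a complex domain with a margin» (older terms: Banach ball; last coupling: relative discs, none through zero coupling — possibility-1-compatible, [I] p. 263 ∕ p. 266).  LOCATED
(hypothesis form; (AR) and the sector datum are the cell's readings, NOT printed as such); N22 NOT discharged. [folklore] -/
theorem ne9_EA_objectsOfRecord₁₃_of_kernelStepRate_genAnalytic (θ : Stage13Params F N) (ℓ : U3Letters₁₁) (hs : ℓ.Signs) (hγ : 0 < θ.γ)
    (hlim : PolLimitsExistOfRecord₁₃ F N θ) {κ₅ C₅ : ℝ} (hC₅ : 0 ≤ C₅) (h5 : KernelStepRateOfRecord₁₃ F N θ κ₅ ℓ.θ₅ C₅)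
    (m' : ℕ) (M : ℕ) [NeZero M] (hM : M = F.L ^ m')
    (Gn : (K : ℕ) → GenTower (F.P K) 𝔸 M) (emb : ReadingMaps F (MatA N) 𝔸)
    (hloc : Localizes17OfRecord₁₃ F N θ (fun K => truncRun K (toClusterTower (Gn K))) emb)
    (sp : (K k : ℕ) → (domSys (F.P K) M (k + 1)).Dom → Set (CPair (F.P K) 𝔸))
    {κ κE δ₀ B₃ r B R r₀ ϱ Mb cw ω₁ ν cS Bq : ℝ} {aw : ℕ → ℕ → ℕ → ℝ}
    (hκ₀ : kappa₀ (4 * 2 ^ 4) (2 * 4) ≤ κ / 2) (hδ₀ : 0 < δ₀) (hB₃ : 0 ≤ B₃) (hr : 0 < r) (hB : 0 ≤ B) (hκE : κ ≤ κE)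
    (Adm : (K k : ℕ) → OlderTerms (F.P K) 𝔸 M k → Prop)
    (hAdm : ∀ K, ∀ g ∈ Window θ.γ, ∀ k, Adm K k (olderOf (recTerm (Gn K) fun n => ((g n : ℝ) : ℂ)) k))
    {Pot : ℕ → ℕ → Type*} [∀ K k, NormedAddCommGroup (Pot K k)] [∀ K k, NormedSpace ℂ (Pot K k)]
    (ρA : (K k : ℕ) → OlderTerms (F.P K) 𝔸 M k → Pot K k) (A : (K k : ℕ) → ℝ → CPair (F.P K) 𝔸 → (domSys (F.P K) M (k + 1)).Dom → Pot K k → ℂ)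
    (hGA : ∀ (K k : ℕ), ∀ t ∈ Ioc (0 : ℝ) θ.γ, ∀ (old : OlderTerms (F.P K) 𝔸 M k), Adm K k old → ∀ (X : (domSys (F.P K) M (k + 1)).Dom), ∀ φ ∈ sp K k X,
      ((Gn K) k).E ((t : ℝ) : ℂ) old φ X = A K k t φ X (ρA K k old))
    (hA : ∀ (K k : ℕ), ∀ t ∈ Ioc (0 : ℝ) θ.γ, ∀ (X : (domSys (F.P K) M (k + 1)).Dom), ∀ φ ∈ sp K k X, DifferentiableOn ℂ (A K k t φ X) (ball 0 R))
    (hMbA : ∀ (K k : ℕ), ∀ t ∈ Ioc (0 : ℝ) θ.γ, ∀ (X : (domSys (F.P K) M (k + 1)).Dom), ∀ φ ∈ sp K k X, ∀ p ∈ ball (0 : Pot K k) R,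
      ‖A K k t φ X p‖ ≤ Mb * Real.exp (-(κE * (domSys (F.P K) M (k + 1)).dj X)))
    (hAdmr : ∀ (K k : ℕ) (old : OlderTerms (F.P K) 𝔸 M k), Adm K k old → ‖ρA K k old‖ ≤ r₀)
    (hρ₁ : ∀ (K k : ℕ) (o o' : OlderTerms (F.P K) 𝔸 M k), Adm K k o → Adm K k o' → ∀ (B' : ℝ), 0 ≤ B' →
      (∀ (k' : ℕ) (hk' : k' < k) (Y : (domSys (F.P K) M (k' + 1)).Dom), ∀ φ' ∈ sp K k' Y,
        aw K k (k' + 1) * (Real.exp (κE * (domSys (F.P K) M (k' + 1)).dj Y) * ‖o ⟨k' + 1, Nat.succ_lt_succ hk'⟩ Y φ' - o' ⟨k' + 1, Nat.succ_lt_succ hk'⟩ Y φ'‖) ≤ B') →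
      ‖ρA K k o - ρA K k o'‖ ≤ B')
    (hρ₂ : ∀ (K k : ℕ) (o₁ o₂ o₃ : OlderTerms (F.P K) 𝔸 M k), Adm K k o₁ → Adm K k o₂ → Adm K k o₃ → ∀ (B' : ℝ), 0 ≤ B' →
      (∀ (k' : ℕ) (hk' : k' < k) (Y : (domSys (F.P K) M (k' + 1)).Dom), ∀ φ' ∈ sp K k' Y,
        aw K k (k' + 1) * (Real.exp (κE * (domSys (F.P K) M (k' + 1)).dj Y) *
          ‖o₁ ⟨k' + 1, Nat.succ_lt_succ hk'⟩ Y φ' - 2 * o₂ ⟨k' + 1, Nat.succ_lt_succ hk'⟩ Y φ' + o₃ ⟨k' + 1, Nat.succ_lt_succ hk'⟩ Y φ'‖) ≤ B') →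
      ‖ρA K k o₁ - (2 : ℂ) • ρA K k o₂ + ρA K k o₃‖ ≤ B')
    (haw : ∀ K k j, 0 ≤ aw K k j) (haw0 : ∀ K k, aw K k 0 = 0) (hawω : ∀ K k j, j ≤ k → aw K k j ≤ cw * ω₁ ^ (k - j)) (hcw : 0 ≤ cw)
    (hMb0 : 0 ≤ Mb) (hϱ : 0 < ϱ) (hR : r₀ + ϱ < R)
    (O : ℕ → Set ℂ) (V : (K k : ℕ) → OlderTerms (F.P K) 𝔸 M k → CPair (F.P K) 𝔸 → (domSys (F.P K) M (k + 1)).Dom → ℂ) (hcS : 0 < cS) (hBq : 0 ≤ Bq)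
    (hballS : ∀ K, ∀ s ∈ Ioc (0 : ℝ) θ.γ, closedBall (s : ℂ) (cS * s) ⊆ O K)
    (hholS : ∀ (K k : ℕ) (old : OlderTerms (F.P K) 𝔸 M k), Adm K k old → ∀ (X : (domSys (F.P K) M (k + 1)).Dom), ∀ φ ∈ sp K k X,
      DifferentiableOn ℂ (fun z => ((Gn K) k).E z old φ X) (O K))
    (hbdS : ∀ (K k : ℕ) (old : OlderTerms (F.P K) 𝔸 M k), Adm K k old → ∀ (X : (domSys (F.P K) M (k + 1)).Dom), ∀ φ ∈ sp K k X, ∀ s ∈ Ioc (0 : ℝ) θ.γ,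
      ∀ z ∈ closedBall (s : ℂ) (cS * s), ‖((Gn K) k).E z old φ X - V K k old φ X‖ ≤ Bq * Real.exp (-(κE * (domSys (F.P K) M (k + 1)).dj X)) * s ^ 2)
    (hω₁ : 0 ≤ ω₁) (hω₁1 : ω₁ ≤ 1) (hν : ω₁ + 4 * Mb * cw / ϱ < ν)
    (hμν : (ω₁ + 4 * Mb * cw / ϱ) ^ 2 ≤ ν) (hν1 : 1 ≤ ν)
    (hbd : ∀ g ∈ Window θ.γ, ∀ (K k : ℕ) (X : (domSys (F.P K) M (k + 1)).Dom), ∀ φ ∈ sp K k X,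
      ‖(truncRun K (toClusterTower (Gn K)) k).E (histPrefix g k) φ X‖ ≤ B * Real.exp (-(κE * (domSys (F.P K) M (k + 1)).dj X)))
    (Ec : ℕ → ℕ → Type*) [∀ K k, NormedAddCommGroup (Ec K k)] [∀ K k, NormedSpace ℂ (Ec K k)]
    (ι : letI := θ.instVβ₁; letI := θ.instVβ₂
      (K k : ℕ) → (domSys (F.P K) M (k + 1)).Dom → ((Fin (F.P K).d → Site (F.P K) (k + 1) → θ.Vβ) →L[ℝ] Ec K k))
    (Φ : (K k : ℕ) → (domSys (F.P K) M (k + 1)).Dom → Ec K k → CPair (F.P K) 𝔸)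
    (U : (K k : ℕ) → (domSys (F.P K) M (k + 1)).Dom → Set (Ec K k)) (hU : ∀ K k X, IsOpen (U K k X)) (hrU : ∀ K k X, ball (0 : Ec K k) r ⊆ U K k X)
    (hEhol : ∀ g ∈ Window θ.γ, ∀ (K k : ℕ) (X : (domSys (F.P K) M (k + 1)).Dom),
      DifferentiableOn ℂ (fun z => (truncRun K (toClusterTower (Gn K)) k).E (histPrefix g k) (Φ K k X z) X) (U K k X))
    (hΦemb : letI := θ.instVβ₁; letI := θ.instVβ₂
      ∀ (K k : ℕ) (X : (domSys (F.P K) M (k + 1)).Dom) (Bf : Fin (F.P K).d → Site (F.P K) (k + 1) → θ.Vβ),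
        Φ K k X (ι K k X Bf) = emb K k (fun l t => NormedSpace.exp (θ.ρ8 (Bf l t))))
    (hΦsp : ∀ (K k : ℕ) (X : (domSys (F.P K) M (k + 1)).Dom), ∀ z ∈ ball (0 : Ec K k) r, Φ K k X z ∈ sp K k X)
    (w : (K k : ℕ) → (domSys (F.P K) M (k + 1)).Dom → Site (F.P K) (k + 1) → ℝ) (hw₀ : ∀ K k X t, 0 ≤ w K k X t)
    (hw : letI := θ.instVβ₁; letI := θ.instVβ₂; letI := θ.instιβ
      ∀ (K k : ℕ) (X : (domSys (F.P K) M (k + 1)).Dom) (l : Fin (F.P K).d) (t : Site (F.P K) (k + 1)) (c : θ.ιβ),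
        ‖ι K k X (Pi.single l (Pi.single t (θ.bV c)))‖ ≤ w K k X t)
    (htail : ∀ (K k : ℕ) (X : (domSys (F.P K) M (k + 1)).Dom) (t : Site (F.P K) (k + 1)),
      let e : Site (F.P K) (k + 1) → TPt 4 (domCount (F.P K) M (k + 1) * M) := fun x i => (ZMod.cast (x i) : ZMod (domCount (F.P K) M (k + 1) * M))
      w K k X t ≤ B₃ * Real.exp (-δ₀ * distCT (domCount (F.P K) M (k + 1)) M (e t) (nearT (M := M) (e t) X)))
    (hκ₅ : delta1 δ₀ κ ((M : ℝ) * 4) ≤ κ₅)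
    (hω : 0 < ℓ.ω) (hθω : ℓ.θ₅ * ν ≤ ℓ.ω ^ 2) (hℓκ : ℓ.κ ≤ delta1 δ₀ κ ((M : ℝ) * 4))
    (hC₉ : (4 * (2 * C₅ / (1 - ℓ.θ₅) + 2 * ((16 * B * B₃ ^ 2 / r ^ 2) * Real.exp (delta1 δ₀ κ ((M : ℝ) * 4) * ((M : ℝ) * 4) * 3) * K₀ (4 * 2 ^ 4) (2 * 4) * K₁ 4 (δ₀ / 2))) / θ.γ +
        ((16 * max ((6 * cS ^ 2 + 32 * cS + 64) / cS ^ 2 * Bq) (64 * Mb * cw ^ 2 / ϱ ^ 2 * (Bq * θ.γ / cS) ^ 2 / (ν - ω₁ - 4 * Mb * cw / ϱ)) * B₃ ^ 2 / r ^ 2) * Real.exp (delta1 δ₀ κ ((M : ℝ) * 4) * ((M : ℝ) * 4) * 3) * K₀ (4 * 2 ^ 4) (2 * 4) *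
          K₁ 4 (δ₀ / 2)) * θ.γ / 2) / ℓ.ω ≤ ℓ.C₉) :
    NE9 ((objectsOfRecord₁₃ F N θ ℓ).EA 0) (Window θ.γ) ℓ.κ ℓ.moduli :=
  ne9_EA_objectsOfRecord₁₃_of_kernelStepRate_genAnalyticReading F N θ ℓ hs hγ hlim hC₅ h5 m' M hM Gn emb hloc sp hκ₀ hδ₀ hB₃ hr hB hκE Adm hAdm ρA A hGA hA hMbA
      hAdmr hρ₁ hρ₂ haw haw0 hawω hcw hMb0 hϱ hR (lam := fun _ _ => Bq * θ.γ / cS) (lam₂ := fun _ _ => (6 * cS ^ 2 + 32 * cS + 64) / cS ^ 2 * Bq)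
      (fun K => genT1last_of_lastSectorHolo (Gn K) (sp K) (Adm K) (V K) hcS hBq (hballS K) (hholS K) (hbdS K)) (fun _ _ => le_rfl) (by positivity)
      (fun K => genT2last_of_lastSectorHolo (Gn K) (sp K) (Adm K) (V K) hcS hBq (hballS K) (hholS K) (hbdS K)) (fun _ _ => le_rfl) (by positivity) hω₁ hω₁1 hν hμν hν1
      hbd Ec ι Φ U hU hrU hEhol hΦemb hΦsp w hw₀ hw htail hκ₅ hω hθω hℓκ hC₉

end YMDAG.N22.KernelFading

end
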